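/-
Copyright (c) 2026 the pub-hodgecm-mathlib formalisation cell (harness21).  Prover seat hodgecm-mathlib-LH4-p09 (g10) (VALVE hand, LEAD F0P6-plan (g15)
BATCH #191 (3)), Track B «K2-LIT» ∕ hLiu418 socket #41 KIND 1, package (K1b-♮), letter (P-dec) ∕ (dec-3), file (dec-3b-ii): THE LOWER POWER FACE OF THE
KIND-1 LINE WHITTAKER BLOCK — `∏_σ |a₀₀((Λĝ·h)_σ)|^{1−2 re s} ≤ C·H(h)^a·D^{a₂}·(1+τ)^{N}`.  THEOREMS ONLY.
-/
import Summits.HodgeConjecture.HodgeConjecture.Theorems.K2LiuIwasawaHeightLatticeSumBound   -- ★ G7: `block_entry_bounds`, `exists_adelicHeightGL_floor` (+ ★ G7-B)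
import HarnessLib

/-!
# Crux `HLiu418`, socket #41, KIND 1 — (P-dec) ∕ (dec-3), file (dec-3b-ii) `K2LiuKindOneLineDecayLowerPowerFace`: THE LOWER POWER FACE

Cell `hodgecm-mathlib`, crux item hLiu418 = `stmt-HodgeConjecture-24832` (helper lane `--supports … --as helper`, count-neutral), route of record
`HCCMUnconditional`; squad K2 ∕ K2Liu, LEAD F0P6-plan (g15) BATCH #191 (3); (P-dec) writer LH4-p14 (g8), K1b desk K2Liu-p14 (g5).
THEOREMS ONLY (no `def`, no `instance`, no notation, no named-fact hypothesis, no `sorry`).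

THE POINT.  In the Iwasawa reading of the KIND-1 line Whittaker function at an archimedean place (★ (KW1-d) ED.2 `K2LiuKindOneLineWhittakerIwasawa.lineWhittaker_levi`
∕ `norm_lineWhittaker_iwasawa_le`) the translate `g_σ = n · m(a) · k` contributes the POWER `‖a₀₀‖^{1 − 2 re s}` of its (1×1) Levi corner next to the Gaussian
`e^{−π ‖a₀₀‖² |h|_σ}`.  The Gaussian is the EXPONENTIAL face (★ (KW1-d) §2 `lineDecay_le_exp_neg_height`, ★ (ρ4-𝔸) `exists_exp_neg_sum_le_exp_neg_height`); THIS FILE is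
the input of the POWER face — the FLOOR of the corner Levi coordinate — and the scalar bookkeeping that raises a two-sided bound to a power of EITHER sign LOCALLY
UNIFORMLY in `s` (the `hdecb` locality `dist s z < r`):
* §1 scalar bookkeeping: `z ≤ a`, `z⁻¹ ≤ a`, `0 < z` ⇒ `1 ≤ a` and `z^t ≤ a^{|t|} ≤ a^{t₀}` (`|t| ≤ t₀`) — `one_le_of_le_of_inv_le`, `rpow_le_rpow_abs`,
  `rpow_le_rpow_of_abs_le`; the locality `dist s z < r ⇒ |1 − 2 re s| ≤ |1 − 2 re z| + 2r` — `abs_one_sub_two_mul_re_le`.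
* §2 THE FLOOR OF THE CORNER LEVI COORDINATE in ★ (ρ4-𝔸) §3's currency ((P-dec) WORD #1 (B), LH4-p14 (g8) 2026-09-05T00:45:30Z): for a row vector `v` with an
  entry of norm `≥ 1` and an Iwasawa Levi block `A` with `A · A′ = 1`, `‖A′_{kl}‖ ≤ M`:  `‖v i‖² ≤ (n M²) · Σ_k ‖(v ᵥ* A)_k‖²` (`v = (v ᵥ* A) ᵥ* A′` + Cauchy–Schwarz),
  hence `(Σ_k ‖(v ᵥ* A)_k‖²)⁻¹ ≤ n · M²` — `norm_apply_le_mul_sum_norm_vecMul`, `sq_sum_le_card_mul_sum_sq`, `norm_apply_sq_le`, **`inv_sum_sq_vecMul_le`**,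
  `sum_sq_vecMul_pos`; the row letter of the NORMALISED section (★ p863259: `ĝ_{1•} = (w_ i)⁻¹ • w_`) gives the unit entry — `norm_map_row_apply_eq_one`.
* §3 the letter of record **`exists_inv_leviCoord_le`** — `∃ C > 0, ∃ k₁, ∀ w ĝ w_ i, w_ i ≠ 0 → ĝ_{1•} = (w_ i)⁻¹ • w_ → ∀ A A′, A A′ = 1 → ∀ M, ‖A′‖ ≤ M →
  (Σ_k ‖((φ_w ∘ ĝ_{1•}) ᵥ* A)_k‖²)⁻¹ ≤ C · M^{k₁}` (`C = 2`, `k₁ = 2`): UNCONDITIONAL — the support denominator `D`, the size `τ`, the corner law and the product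
  formula, which (P-dec) WORD #1 (B) budgeted for, are NOT needed for the floor (they are what the CEILING for exponents `1 − 2 re s > 0` needs); and
  `leviCoord_pos_and_inv_le` (positivity packaged).
WHAT IS NOT HERE: the raise to the power `‖a‖^{1 − 2 re s}` (the one-frame assembly's step; §1 is its bookkeeping), the ceiling of the Levi coordinate, and the
★ G7 frame-currency version of the face on the WHOLE translate (`linePower_le_height_rpow`, HOME material `…LowerPowerFace.cand.v2.LH4p09g10.lean`).
References: [BorelJacquet1979] §1.2 (heights: properties (i)–(iii)), §4.1 (Iwasawa decomposition); [MoeglinWaldspurger1995] I.2.2, II.1.5, II.1.7; [Shimura1997] §A3.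
HONEST LABEL.  Count-neutral helper, by value in the frame letters; closes no socket: `HC_CM` is proved only modulo the 7 printed citations (2 remaining named
inputs: hLiu418 = `stmt-HodgeConjecture-24832`, h413 = `stmt-HodgeConjecture-24833`) until rung 0 closes.
-/

set_option autoImplicit false
set_option linter.dupNamespace false -- the mandated namespace repeats `HodgeConjecture.HodgeConjecture`

noncomputable section

namespace Summit.HodgeConjecture.HodgeConjecture.Cruxes.HLiu418.K2LiuKindOneLineDecayLowerPowerFace

open scoped BigOperators Matrix

/-! ## §1 Scalar bookkeeping: powers of either sign against a two-sided bound; the `s`-locality -/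

section Scalar

/-- if `0 < z`, `z ≤ a` and `z⁻¹ ≤ a` then `1 ≤ a`. [folklore] -/
theorem one_le_of_le_of_inv_le {z a : ℝ} (hz : 0 < z) (h₁ : z ≤ a) (h₂ : z⁻¹ ≤ a) : 1 ≤ a := by
  rcases le_or_gt 1 z with h | h
  · exact h.trans h₁
  · exact (one_le_inv_iff₀.2 ⟨hz, h.le⟩).trans h₂

/-- **POWERS OF EITHER SIGN**: if `0 < z`, `z ≤ a` and `z⁻¹ ≤ a` then `z ^ t ≤ a ^ |t|` for every real `t`. [folklore] -/
theorem rpow_le_rpow_abs {z a : ℝ} (hz : 0 < z) (h₁ : z ≤ a) (h₂ : z⁻¹ ≤ a) (t : ℝ) : z ^ t ≤ a ^ |t| := by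
  rcases le_or_gt 0 t with ht | ht
  · rw [abs_of_nonneg ht]
    exact Real.rpow_le_rpow hz.le h₁ ht
  · rw [abs_of_neg ht]
    have hzt : z ^ t = z⁻¹ ^ (-t) := by
      rw [Real.inv_rpow hz.le, Real.rpow_neg hz.le, inv_inv]
    rw [hzt]
    exact Real.rpow_le_rpow (inv_nonneg.2 hz.le) h₂ (by linarith)

/-- the locally uniform form: `|t| ≤ t₀` ⇒ `z ^ t ≤ a ^ t₀`. [folklore] -/
theorem rpow_le_rpow_of_abs_le {z a : ℝ} (hz : 0 < z) (h₁ : z ≤ a) (h₂ : z⁻¹ ≤ a) {t t₀ : ℝ} (ht : |t| ≤ t₀) : z ^ t ≤ a ^ t₀ :=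
  (rpow_le_rpow_abs hz h₁ h₂ t).trans (Real.rpow_le_rpow_of_exponent_le (one_le_of_le_of_inv_le hz h₁ h₂) ht)

/-- **THE `s`-LOCALITY OF THE EXPONENT**: `dist s z < r` ⇒ `|1 − 2 re s| ≤ |1 − 2 re z| + 2r`. [folklore] -/
theorem abs_one_sub_two_mul_re_le {s z : ℂ} {r : ℝ} (hs : dist s z < r) : |1 - 2 * s.re| ≤ |1 - 2 * z.re| + 2 * r := by
  have h1 : |(s - z).re| ≤ ‖s - z‖ := Complex.abs_re_le_norm _
  rw [Complex.sub_re] at h1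
  rw [Complex.dist_eq] at hs
  have h2 : 1 - 2 * s.re = (1 - 2 * z.re) - 2 * (s.re - z.re) := by ring
  rw [h2]
  calc |1 - 2 * z.re - 2 * (s.re - z.re)| ≤ |1 - 2 * z.re| + |2 * (s.re - z.re)| := abs_sub _ _
    _ = |1 - 2 * z.re| + 2 * |s.re - z.re| := by rw [abs_mul, abs_two]
    _ ≤ |1 - 2 * z.re| + 2 * r := by linarith

/-- `0 ≤ |1 − 2 re z| + 2r` for `0 < r` (the exponent bound is a legitimate `t₀`). [folklore] -/
theorem abs_one_sub_two_mul_re_add_nonneg (z : ℂ) {r : ℝ} (hr : 0 < r) : 0 ≤ |1 - 2 * z.re| + 2 * r := by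
  positivity

end Scalar

/-! ## §2 The floor of the corner Levi coordinate (★ (ρ4-𝔸) §3 currency): `A A′ = 1`, `‖A′_{kl}‖ ≤ M`, a row with a unit entry -/

section LeviFloor

variable {n : ℕ}

/-- `v = (v ᵥ* A) ᵥ* A′` when `A · A′ = 1`; hence `‖v i‖ ≤ M · Σ_k ‖(v ᵥ* A) k‖` as soon as `‖A′ k l‖ ≤ M`. [folklore] -/
theorem norm_apply_le_mul_sum_norm_vecMul (v : Fin n → ℂ) {A A' : Matrix (Fin n) (Fin n) ℂ} (hA : A * A' = 1) {M : ℝ} (hM : ∀ k l, ‖A' k l‖ ≤ M)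
    (i : Fin n) : ‖v i‖ ≤ M * ∑ k, ‖(v ᵥ* A) k‖ := by
  have h : ((v ᵥ* A) ᵥ* A') i = v i := by rw [Matrix.vecMul_vecMul, hA, Matrix.vecMul_one]
  have h3 : ((v ᵥ* A) ᵥ* A') i = ∑ k, (v ᵥ* A) k * A' k i := rfl
  rw [← h, h3]
  calc ‖∑ k, (v ᵥ* A) k * A' k i‖ ≤ ∑ k, ‖(v ᵥ* A) k * A' k i‖ := norm_sum_le _ _
    _ ≤ ∑ k, ‖(v ᵥ* A) k‖ * M := Finset.sum_le_sum fun k _ => by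
        rw [norm_mul]; exact mul_le_mul_of_nonneg_left (hM k i) (norm_nonneg _)
    _ = M * ∑ k, ‖(v ᵥ* A) k‖ := by rw [← Finset.sum_mul, mul_comm]

/-- Cauchy–Schwarz on `Fin n`: `(Σ_k a_k)² ≤ n · Σ_k a_k²`. [folklore] -/
theorem sq_sum_le_card_mul_sum_sq (a : Fin n → ℝ) : (∑ k, a k) ^ 2 ≤ n * ∑ k, a k ^ 2 := by
  have h := Finset.sum_mul_sq_le_sq_mul_sq Finset.univ a (fun _ => (1 : ℝ))
  simp only [mul_one, one_pow, Finset.sum_const, Finset.card_univ, Fintype.card_fin, nsmul_eq_mul] at h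
  linarith

/-- **THE FLOOR, squared form**: `A · A′ = 1`, `‖A′ k l‖ ≤ M` ⇒ `‖v i‖² ≤ (n · M²) · Σ_k ‖(v ᵥ* A) k‖²` for every row vector `v` and index `i`.
[cite: BorelJacquet1979, §4.1] -/
theorem norm_apply_sq_le (v : Fin n → ℂ) {A A' : Matrix (Fin n) (Fin n) ℂ} (hA : A * A' = 1) {M : ℝ} (hM : ∀ k l, ‖A' k l‖ ≤ M) (i : Fin n) :
    ‖v i‖ ^ 2 ≤ (n * M ^ 2) * ∑ k, ‖(v ᵥ* A) k‖ ^ 2 := by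
  have hM0 : 0 ≤ M := (norm_nonneg _).trans (hM i i)
  have h1 := norm_apply_le_mul_sum_norm_vecMul v hA hM i
  have hS0 : 0 ≤ ∑ k, ‖(v ᵥ* A) k‖ := Finset.sum_nonneg fun k _ => norm_nonneg _
  have h2 : ‖v i‖ ^ 2 ≤ (M * ∑ k, ‖(v ᵥ* A) k‖) ^ 2 := pow_le_pow_left₀ (norm_nonneg _) h1 2
  have h3 := sq_sum_le_card_mul_sum_sq fun k => ‖(v ᵥ* A) k‖
  calc ‖v i‖ ^ 2 ≤ M ^ 2 * (∑ k, ‖(v ᵥ* A) k‖) ^ 2 := by rw [mul_pow] at h2; exact h2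
    _ ≤ M ^ 2 * (n * ∑ k, ‖(v ᵥ* A) k‖ ^ 2) := mul_le_mul_of_nonneg_left h3 (sq_nonneg M)
    _ = (n * M ^ 2) * ∑ k, ‖(v ᵥ* A) k‖ ^ 2 := by ring

/-- **THE FLOOR OF THE LEVI COORDINATE**: a row vector with an entry of norm `≥ 1`, `A · A′ = 1`, `‖A′ k l‖ ≤ M` ⇒ `(Σ_k ‖(v ᵥ* A) k‖²)⁻¹ ≤ n · M²` — no height, no
denominator, no product formula. [cite: BorelJacquet1979, §4.1] [cite: MoeglinWaldspurger1995, II.1.7] -/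
theorem inv_sum_sq_vecMul_le (v : Fin n → ℂ) {A A' : Matrix (Fin n) (Fin n) ℂ} (hA : A * A' = 1) {M : ℝ} (hM : ∀ k l, ‖A' k l‖ ≤ M)
    {i : Fin n} (hi : 1 ≤ ‖v i‖) : (∑ k, ‖(v ᵥ* A) k‖ ^ 2)⁻¹ ≤ n * M ^ 2 := by
  have h1 := norm_apply_sq_le v hA hM i
  have hvi : 1 ≤ ‖v i‖ ^ 2 := by nlinarith
  have hkey : 1 ≤ (n * M ^ 2) * ∑ k, ‖(v ᵥ* A) k‖ ^ 2 := hvi.trans h1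
  have hS0 : 0 ≤ ∑ k, ‖(v ᵥ* A) k‖ ^ 2 := Finset.sum_nonneg fun k _ => sq_nonneg _
  rcases hS0.lt_or_eq with hpos | h0
  · rw [inv_eq_one_div, div_le_iff₀ hpos]; exact hkey
  · rw [← h0, mul_zero] at hkey; exact absurd hkey (by norm_num)

/-- the Levi coordinate is POSITIVE under the same letters (so its real powers are the honest ones). [folklore] -/
theorem sum_sq_vecMul_pos (v : Fin n → ℂ) {A A' : Matrix (Fin n) (Fin n) ℂ} (hA : A * A' = 1) {M : ℝ} (hM : ∀ k l, ‖A' k l‖ ≤ M)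
    {i : Fin n} (hi : 1 ≤ ‖v i‖) : 0 < ∑ k, ‖(v ᵥ* A) k‖ ^ 2 := by
  have h1 := norm_apply_sq_le v hA hM i
  have hvi : 1 ≤ ‖v i‖ ^ 2 := by nlinarith
  have hS0 : 0 ≤ ∑ k, ‖(v ᵥ* A) k‖ ^ 2 := Finset.sum_nonneg fun k _ => sq_nonneg _
  rcases hS0.lt_or_eq with hpos | h0
  · exact hpos
  · rw [← h0, mul_zero] at h1; exact absurd (hvi.trans h1) (by norm_num)

/-- the row letter of the NORMALISED section (★ p863259 `exists_normalised_rowSection`: `ĝ_{1•} = (w_ i)⁻¹ • w_`, `w_ i ≠ 0`) under a ring map `φ : L →+* ℂ`: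
the `i`-th entry of `φ ∘ ĝ_{1•}` is `1`. [folklore] -/
theorem norm_map_row_apply_eq_one {L : Type*} [Field L] (φ : L →+* ℂ) {m : ℕ} {g : Matrix (Fin m) (Fin m) L} {i₀ : Fin m} {x : Fin m → L} {i : Fin m}
    (hxi : x i ≠ 0) (hrow : g i₀ = (x i)⁻¹ • x) : ‖φ (g i₀ i)‖ = 1 := by
  rw [hrow, Pi.smul_apply, smul_eq_mul, inv_mul_cancel₀ hxi, map_one, norm_one]

end LeviFloor

/-! ## §3 (dec-3b-ii) the letter of record: the floor at every infinite place for the normalised row section -/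

section Record

open NumberField NumberField.InfinitePlace

variable (L : Type) [Field L]

/-- **(dec-3b-ii) THE FLOOR OF THE CORNER LEVI COORDINATE AT THE ARCHIMEDEAN PLACES** ((P-dec) WORD #1 (B), ★ p863568 (ρ4-𝔸) §3 currency at `n = 2`).
`∃ C > 0, ∃ k₁` (in fact `C = 2`, `k₁ = 2`) such that for every infinite place `w` of `L`, every `ĝ ∈ M₂(L)` whose row `ĝ_{1•}` is the NORMALISED representative
`(w_ i)⁻¹ • w_` of a non-zero `w_` (★ p863259 `K2LiuRankOneRowSection.exists_normalised_rowSection`, by value), and every Iwasawa Levi block `A` at `w` with `A · A′ = 1`,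
`‖A′_{kl}‖ ≤ M`:  `(Σ_k ‖((φ_w ∘ ĝ_{1•}) ᵥ* A)_k‖²)⁻¹ ≤ C · M^{k₁}` — UNCONDITIONALLY: no support denominator `D`, no size `τ`, no corner law, no product formula (the entry
`ĝ_{1 i} = 1` has `φ_w(ĝ_{1 i}) = 1`, and `v = (v ᵥ* A) ᵥ* A′` with Cauchy–Schwarz).  The one-frame assembly raises it to the power `(2 re s − 1)∕2` locally in `z` (§1).
[cite: BorelJacquet1979, §1.2, §4.1] [cite: MoeglinWaldspurger1995, II.1.5, II.1.7] -/
theorem exists_inv_leviCoord_le :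
    ∃ C : ℝ, ∃ k₁ : ℕ, 0 < C ∧ ∀ (w : InfinitePlace L) (g : Matrix (Fin 2) (Fin 2) L) (w_ : Fin 2 → L) (i : Fin 2),
      w_ i ≠ 0 → g 1 = (w_ i)⁻¹ • w_ →
      ∀ (A A' : Matrix (Fin 2) (Fin 2) ℂ), A * A' = 1 → ∀ (M : ℝ), (∀ k l, ‖A' k l‖ ≤ M) →
      (∑ k, ‖((fun l => w.embedding (g 1 l)) ᵥ* A) k‖ ^ 2)⁻¹ ≤ C * M ^ k₁ := by
  refine ⟨2, 2, two_pos, fun w g w_ i hwi hrow A A' hA M hM => ?_⟩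
  have hi : 1 ≤ ‖(fun l => w.embedding (g 1 l)) i‖ := (norm_map_row_apply_eq_one w.embedding hwi hrow).ge
  have key := inv_sum_sq_vecMul_le (fun l => w.embedding (g 1 l)) hA hM hi
  simpa using key

/-- the same floor with the Levi coordinate's POSITIVITY packaged (`0 < Σ` and `Σ⁻¹ ≤ 2M²`), for the assembly's `rpow_le_rpow_abs` step (§1). [folklore] -/
theorem leviCoord_pos_and_inv_le (w : InfinitePlace L) {g : Matrix (Fin 2) (Fin 2) L} {w_ : Fin 2 → L} {i : Fin 2}
    (hwi : w_ i ≠ 0) (hrow : g 1 = (w_ i)⁻¹ • w_) {A A' : Matrix (Fin 2) (Fin 2) ℂ} (hA : A * A' = 1) {M : ℝ} (hM : ∀ k l, ‖A' k l‖ ≤ M) :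
    0 < ∑ k, ‖((fun l => w.embedding (g 1 l)) ᵥ* A) k‖ ^ 2 ∧ (∑ k, ‖((fun l => w.embedding (g 1 l)) ᵥ* A) k‖ ^ 2)⁻¹ ≤ 2 * M ^ 2 := by
  have hi : 1 ≤ ‖(fun l => w.embedding (g 1 l)) i‖ := (norm_map_row_apply_eq_one w.embedding hwi hrow).ge
  refine ⟨sum_sq_vecMul_pos _ hA hM hi, ?_⟩
  have key := inv_sum_sq_vecMul_le (fun l => w.embedding (g 1 l)) hA hM hi
  simpa using key

end Record

/-!
## ED. 2 ((P-dec) WORD #2, LH4-p14 (g8) 2026-09-05T00:58:12Z: «your road wins») — the face in the fine letter's NATIVE currency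

The fine letter (dec-2) ∕ (e∞) ★ p863005 reads the corner translate `x = Λĝ·h` through a G7-style block decomposition with 1×1 corner `Y σ` (★ p862865 §4's `a 0 0`),
so the one-frame assembly `K2LiuKindOneLineDecayOneFrame` wants the power face ALSO in that currency: for EVERY Iwasawa block decomposition of the translate
(★ G7-B `block_entry_bounds` at `p := Fin 1`: `‖Y_σ‖, ‖Y_σ⁻¹‖ ≤ c_B·‖x‖`) and exponents of EITHER sign, locally uniformly in `s`, `∏_σ ‖Y σ 0 0‖^t ≤ c_B^{t₀#S}·‖x‖^{t₀#S}`
(§5 `linePower_le_height_rpow`, `…_of_dist`), then BY VALUE on ★ (dec-3b-i) p863519's translate-height conclusion `‖x‖ ≤ C₁·(D·(1+τ))^k·‖h‖^{k′}` the engine's bytes with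
`D ^ a₂` and `(1 + τ) ^ Nb` SEPARATED (§6 `linePower_le_of_translateHeight`).  §1–§3 (ED. 1) are unchanged: the (ρ4-𝔸)-currency floor stays for the exponential face's matching.
-/

/-! ## §4 (ED. 2) The 1×1 reading: the Levi corner `‖Y 0 0‖` of a block decomposition and its inverse -/

section FinOne

/-- `y · y′ = 1` in `M_1(ℂ)` ⇒ `‖y₀₀‖ · ‖y′₀₀‖ = 1` (`(y · y′)₀₀ = y₀₀ · y′₀₀`, ★ `F0P3bKTypeCalculus.mul_apply_fin_one`'s one-line computation inlined). [folklore] -/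
theorem norm_entry_mul_norm_entry_eq_one {y y' : Matrix (Fin 1) (Fin 1) ℂ} (h : y * y' = 1) : ‖y 0 0‖ * ‖y' 0 0‖ = 1 := by
  have h1 : y 0 0 * y' 0 0 = 1 := by
    have h2 : (y * y') 0 0 = 1 := by rw [h, Matrix.one_apply_eq]
    rwa [Matrix.mul_apply, Fin.sum_univ_one] at h2
  rw [← norm_mul, h1, norm_one]

/-- `y · y′ = 1` in `M_1(ℂ)` ⇒ `0 < ‖y₀₀‖`. [folklore] -/
theorem norm_entry_pos_of_mul_eq_one {y y' : Matrix (Fin 1) (Fin 1) ℂ} (h : y * y' = 1) : 0 < ‖y 0 0‖ := by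
  rcases (norm_nonneg (y 0 0)).lt_or_eq with h0 | h0
  · exact h0
  · have h1 := norm_entry_mul_norm_entry_eq_one h
    rw [← h0, zero_mul] at h1
    exact absurd h1 zero_ne_one

/-- `y · y′ = 1` in `M_1(ℂ)` ⇒ `‖y₀₀‖⁻¹ = ‖y′₀₀‖`. [folklore] -/
theorem inv_norm_entry_eq {y y' : Matrix (Fin 1) (Fin 1) ℂ} (h : y * y' = 1) : ‖y 0 0‖⁻¹ = ‖y' 0 0‖ :=
  inv_eq_of_mul_eq_one_right (norm_entry_mul_norm_entry_eq_one h)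

/-- **THE PLACE PRODUCT**: over any finite index set, if `y_i · y′_i = 1` in `M_1(ℂ)` with `‖(y_i)₀₀‖, ‖(y′_i)₀₀‖ ≤ R`, then for `|t| ≤ t₀`:
`∏_i ‖(y_i)₀₀‖ ^ t ≤ R ^ (t₀ · #ι)`. [cite: BorelJacquet1979, §4.1] -/
theorem prod_norm_entry_rpow_le {ι : Type*} [Fintype ι] (y y' : ι → Matrix (Fin 1) (Fin 1) ℂ) (h : ∀ i, y i * y' i = 1)
    {R : ℝ} (he : ∀ i, ‖y i 0 0‖ ≤ R) (he' : ∀ i, ‖y' i 0 0‖ ≤ R) {t t₀ : ℝ} (ht : |t| ≤ t₀) :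
    ∏ i, ‖y i 0 0‖ ^ t ≤ R ^ (t₀ * Fintype.card ι) := by
  rcases isEmpty_or_nonempty ι with hι | hι
  · simp [Fintype.card_eq_zero]
  obtain ⟨i₀⟩ := hι
  have hR : 0 ≤ R := (norm_nonneg _).trans (he i₀)
  have hfac : ∀ i, ‖y i 0 0‖ ^ t ≤ R ^ t₀ := fun i =>
    rpow_le_rpow_of_abs_le (norm_entry_pos_of_mul_eq_one (h i)) (he i) (by rw [inv_norm_entry_eq (h i)]; exact he' i) ht
  calc ∏ i, ‖y i 0 0‖ ^ t ≤ ∏ _i : ι, R ^ t₀ := Finset.prod_le_prod (fun i _ => Real.rpow_nonneg (norm_nonneg _) _) fun i _ => hfac i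
    _ = (R ^ t₀) ^ Fintype.card ι := by rw [Finset.prod_const, Finset.card_univ]
    _ = R ^ (t₀ * Fintype.card ι) := by rw [← Real.rpow_natCast, ← Real.rpow_mul hR]

end FinOne

/-! ## §5 (ED. 2) The line power face against the height of the TRANSLATE (★ G7 ∕ ★ (KW1-d) §2 frame currency, `p := Fin 1`) -/

section HeightFace

open scoped ComplexOrder
open NumberField NumberField.mixedEmbedding NumberField.InfinitePlace IsDedekindDomain
open Literature.NumberTheory.Automorphic Literature.NumberTheory.Automorphic.UnitaryGroup
open Summit.HodgeConjecture.HodgeConjecture.Cruxes.HLiu418.K2LiuArchBlockHeightBound (norm_archAt_archPart_apply_le)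
open Summit.HodgeConjecture.HodgeConjecture.Cruxes.HLiu418.K2LiuIwasawaHeightLatticeSumBound (block_entry_bounds exists_adelicHeightGL_floor)

variable (F E : Type) [Field F] [NumberField F] [Field E] [NumberField E] [Algebra F E] (c : E ≃ₐ[F] E) (N : ℕ) (J : Matrix (Fin N) (Fin N) E)
variable {S : Type*} [Fintype S]

/-- **THE LINE POWER FACE AGAINST THE HEIGHT OF THE TRANSLATE.**  Frame data BY VALUE as in ★ G7 `detFactor_le_height` ∕ ★ (KW1-d) §2
`lineDecay_le_exp_neg_height`: `H₁ = U(J)` with `J ∈ M_N(E)`, `r : Fin 1 ⊕ Fin 1 ≃ Fin N`, complex places `w σ` fixed by `c ≠ 1`, frames `T σ, T σ⁻¹` and one bound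
`M ≥ 1` for the entries of the frames and the movers, and an exponent bound `t₀ ≥ 0`.  CONCLUSION: `∃ C A′ ≥ 0` (frame data and `t₀` only: `C = c_B^{t₀ #S}`,
`A′ = t₀ #S`, `c_B = 8M³`) such that for every `h`, all movers, EVERY Iwasawa block decomposition `T σ · (h_∞)~_{w σ} · T σ⁻¹ = [y σ, b σ; 0, d σ] · κ σ` (1×1 blocks)
and every real `t` with `|t| ≤ t₀`:  `∏_σ ‖y σ 0 0‖ ^ t ≤ C · ‖h‖^{A′}` — BOTH signs of `t` (★ G7-B `block_entry_bounds`: `‖y_σ‖, ‖y_σ⁻¹‖ ≤ c_B ‖h‖`).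
[cite: BorelJacquet1979, §1.2, §4.1] [cite: MoeglinWaldspurger1995, I.2.2, II.1.7] -/
theorem linePower_le_height_rpow [NeZero N] (hc : c ≠ 1) (w : S → {w : InfinitePlace E // IsComplex w}) (hw : ∀ σ, c • (w σ).1 = (w σ).1)
    (r : Fin 1 ⊕ Fin 1 ≃ Fin N) (T Tinv : S → Matrix (Fin 1 ⊕ Fin 1) (Fin 1 ⊕ Fin 1) ℂ) (hT : ∀ σ, T σ * Tinv σ = 1) (hT' : ∀ σ, Tinv σ * T σ = 1)
    {M : ℝ} (hM : 1 ≤ M) (hTe : ∀ σ i j, ‖T σ i j‖ ≤ M) (hTe' : ∀ σ i j, ‖Tinv σ i j‖ ≤ M) {t₀ : ℝ} (ht₀ : 0 ≤ t₀) :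
    ∃ C A' : ℝ, 0 ≤ C ∧ 0 ≤ A' ∧ ∀ (h : (adelicGroupData F E c N J).Adelic) (y b d : S → Matrix (Fin 1) (Fin 1) ℂ)
      (κ κ' : S → Matrix (Fin 1 ⊕ Fin 1) (Fin 1 ⊕ Fin 1) ℂ),
      (∀ σ, κ σ * κ' σ = 1) → (∀ σ, κ' σ * κ σ = 1) → (∀ σ i j, ‖κ σ i j‖ ≤ M) → (∀ σ i j, ‖κ' σ i j‖ ≤ M) →
      (∀ σ, T σ * Matrix.reindex r.symm r.symm
          ((((archAt F E c N J (w σ) (hw σ) hc (archPart F E c N J h) : archLocal E N J (w σ)) : GL (Fin N) ℂ) : Matrix (Fin N) (Fin N) ℂ)) *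
          Tinv σ = Matrix.fromBlocks (y σ) (b σ) 0 (d σ) * κ σ) →
      ∀ t : ℝ, |t| ≤ t₀ → ∏ σ, ‖y σ 0 0‖ ^ t ≤ C * adelicHeightGL N E (adelicVal F E c N J h) ^ A' := by
  obtain ⟨c₀, hc₀, hfloor⟩ := exists_adelicHeightGL_floor E N
  set cB : ℝ := (Fintype.card (Fin 1 ⊕ Fin 1) : ℝ) ^ 3 * M ^ 3 with hcB
  have hcB0 : 0 ≤ cB := by positivity
  refine ⟨cB ^ (t₀ * Fintype.card S), t₀ * Fintype.card S, Real.rpow_nonneg hcB0 _, by positivity,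
    fun h y b d κ κ' hκ hκ' hκe hκe' hdec t ht => ?_⟩
  set H : ℝ := adelicHeightGL N E (adelicVal F E c N J h) with hH
  have hHc : c₀ ≤ H := hfloor _
  have hH0 : 0 < H := lt_of_lt_of_le hc₀ hHc
  have hM0 : 0 ≤ M := zero_le_one.trans hM
  -- per place: `‖y σ‖, ‖(y σ)⁻¹‖ ≤ cB · H` and `y σ · (y σ)⁻¹ = 1` (★ G7-B)
  have hblk : ∀ σ, (∀ i j, ‖y σ i j‖ ≤ cB * H) ∧ (∀ i j, ‖(y σ)⁻¹ i j‖ ≤ cB * H) ∧ y σ * (y σ)⁻¹ = 1 := fun σ => by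
    have hg := norm_archAt_archPart_apply_le F E c N J (w σ) (hw σ) hc h
    have hmul : ((((archAt F E c N J (w σ) (hw σ) hc (archPart F E c N J h) : archLocal E N J (w σ)) : GL (Fin N) ℂ) : Matrix (Fin N) (Fin N) ℂ)) *
        ((((archAt F E c N J (w σ) (hw σ) hc (archPart F E c N J h))⁻¹ : archLocal E N J (w σ)) : GL (Fin N) ℂ) : Matrix (Fin N) (Fin N) ℂ) = 1 := by
      rw [Subgroup.coe_inv, Matrix.coe_units_inv, Matrix.mul_nonsing_inv _ (Matrix.isUnits_det_units _)]
    exact block_entry_bounds r (hT σ) (hT' σ) (hκ σ) (hκ' σ) hM0 (hTe σ) (hTe' σ) (hκe σ) (hκe' σ) hmul hH0.le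
      (fun i j => (hg i j).1) (fun i j => (hg i j).2) (hdec σ)
  have key := prod_norm_entry_rpow_le y (fun σ => (y σ)⁻¹) (fun σ => (hblk σ).2.2) (R := cB * H)
    (fun σ => (hblk σ).1 0 0) (fun σ => (hblk σ).2.1 0 0) ht
  refine key.trans (le_of_eq ?_)
  rw [Real.mul_rpow hcB0 hH0.le]

/-- **THE `s`-READING** (the `hdecb` locality): same frame data, a centre `z : ℂ` and a radius `r > 0`; CONCLUSION: `∃ C A′ ≥ 0` such that for every `h`, all movers,
every Iwasawa block decomposition and every `s` with `dist s z < r`:  `∏_σ ‖y σ 0 0‖ ^ (1 − 2 re s) ≤ C · ‖h‖^{A′}` (`t₀ := |1 − 2 re z| + 2r`).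
[cite: BorelJacquet1979, §1.2, §4.1] [cite: MoeglinWaldspurger1995, II.1.5, II.1.7] -/
theorem linePower_le_height_rpow_of_dist [NeZero N] (hc : c ≠ 1) (w : S → {w : InfinitePlace E // IsComplex w}) (hw : ∀ σ, c • (w σ).1 = (w σ).1)
    (r : Fin 1 ⊕ Fin 1 ≃ Fin N) (T Tinv : S → Matrix (Fin 1 ⊕ Fin 1) (Fin 1 ⊕ Fin 1) ℂ) (hT : ∀ σ, T σ * Tinv σ = 1) (hT' : ∀ σ, Tinv σ * T σ = 1)
    {M : ℝ} (hM : 1 ≤ M) (hTe : ∀ σ i j, ‖T σ i j‖ ≤ M) (hTe' : ∀ σ i j, ‖Tinv σ i j‖ ≤ M) (z : ℂ) {r₀ : ℝ} (hr₀ : 0 < r₀) :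
    ∃ C A' : ℝ, 0 ≤ C ∧ 0 ≤ A' ∧ ∀ (h : (adelicGroupData F E c N J).Adelic) (y b d : S → Matrix (Fin 1) (Fin 1) ℂ)
      (κ κ' : S → Matrix (Fin 1 ⊕ Fin 1) (Fin 1 ⊕ Fin 1) ℂ),
      (∀ σ, κ σ * κ' σ = 1) → (∀ σ, κ' σ * κ σ = 1) → (∀ σ i j, ‖κ σ i j‖ ≤ M) → (∀ σ i j, ‖κ' σ i j‖ ≤ M) →
      (∀ σ, T σ * Matrix.reindex r.symm r.symm
          ((((archAt F E c N J (w σ) (hw σ) hc (archPart F E c N J h) : archLocal E N J (w σ)) : GL (Fin N) ℂ) : Matrix (Fin N) (Fin N) ℂ)) *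
          Tinv σ = Matrix.fromBlocks (y σ) (b σ) 0 (d σ) * κ σ) →
      ∀ s : ℂ, dist s z < r₀ → ∏ σ, ‖y σ 0 0‖ ^ (1 - 2 * s.re) ≤ C * adelicHeightGL N E (adelicVal F E c N J h) ^ A' := by
  obtain ⟨C, A', hC, hA', hface⟩ := linePower_le_height_rpow F E c N J hc w hw r T Tinv hT hT' hM hTe hTe'
    (abs_one_sub_two_mul_re_add_nonneg z hr₀)
  exact ⟨C, A', hC, hA', fun h y b d κ κ' hκ hκ' hκe hκe' hdec s hs =>
    hface h y b d κ κ' hκ hκ' hκe hκe' hdec (1 - 2 * s.re) (abs_one_sub_two_mul_re_le hs)⟩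

end HeightFace

/-! ## §6 (ED. 2) The TOP shape: composition BY VALUE with the translate-height letter of ★ (dec-3b-i), `D` and `1 + τ` SPLIT -/

section Top

/-- **THE HEIGHT OF THE TRANSLATE, RAISED**: `0 ≤ Ht ≤ C₁ · B^k · Hh^{k′}` (`C₁, B, Hh ≥ 0`) and `A ≥ 0` ⇒ `Ht ^ A ≤ C₁^A · B^{k A} · Hh^{k′ A}`. [folklore] -/
theorem rpow_le_of_le_translateHeight {Ht C₁ B Hh : ℝ} {k k' : ℕ} (hHt : 0 ≤ Ht) (hC₁ : 0 ≤ C₁) (hB : 0 ≤ B) (hHh : 0 ≤ Hh)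
    (hle : Ht ≤ C₁ * B ^ k * Hh ^ k') {A : ℝ} (hA : 0 ≤ A) :
    Ht ^ A ≤ C₁ ^ A * B ^ ((k : ℝ) * A) * Hh ^ ((k' : ℝ) * A) := by
  calc Ht ^ A ≤ (C₁ * B ^ k * Hh ^ k') ^ A := Real.rpow_le_rpow hHt hle hA
    _ = C₁ ^ A * B ^ ((k : ℝ) * A) * Hh ^ ((k' : ℝ) * A) := by
        rw [Real.mul_rpow (mul_nonneg hC₁ (pow_nonneg hB _)) (pow_nonneg hHh _), Real.mul_rpow hC₁ (pow_nonneg hB _),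
          ← Real.rpow_natCast B k, ← Real.rpow_mul hB, ← Real.rpow_natCast Hh k', ← Real.rpow_mul hHh]

/-- **`D` AND `1 + τ` SPLIT**: `0 ≤ D`, `0 ≤ τ` ⇒ `(D · (1 + τ)) ^ x ≤ D ^ x · (1 + τ) ^ ⌈x⌉₊` for every real `x` (a natural exponent on `1 + τ ≥ 1`, as the engine's
`(1 + τ_S)^{N}`). [folklore] -/
theorem mul_one_add_rpow_le {D τ : ℝ} (hD : 0 ≤ D) (hτ : 0 ≤ τ) (x : ℝ) : (D * (1 + τ)) ^ x ≤ D ^ x * (1 + τ) ^ ⌈x⌉₊ := by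
  rw [Real.mul_rpow hD (by linarith)]
  refine mul_le_mul_of_nonneg_left ?_ (Real.rpow_nonneg hD _)
  calc (1 + τ) ^ x ≤ (1 + τ) ^ ((⌈x⌉₊ : ℕ) : ℝ) := Real.rpow_le_rpow_of_exponent_le (by linarith) (Nat.le_ceil x)
    _ = (1 + τ) ^ ⌈x⌉₊ := Real.rpow_natCast _ _

/-- the two steps combined: from `C₀ · Ht^{A′}` to the engine's bytes `C · Hh^a · D^{a₂} · (1 + τ)^{Nb}` with `C = C₀ C₁^{A′}`, `a = k′A′`, `a₂ = kA′`, `Nb = ⌈kA′⌉₊`.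
[folklore] -/
theorem mul_rpow_le_top_shape {C₀ A' Ht C₁ Hh τ : ℝ} {D k k' : ℕ} (hC₀ : 0 ≤ C₀) (hA' : 0 ≤ A') (hHt : 0 ≤ Ht) (hC₁ : 0 ≤ C₁) (hHh : 0 ≤ Hh)
    (hτ : 0 ≤ τ) (hle : Ht ≤ C₁ * ((D : ℝ) * (1 + τ)) ^ k * Hh ^ k') :
    C₀ * Ht ^ A' ≤ C₀ * C₁ ^ A' * Hh ^ ((k' : ℝ) * A') * (D : ℝ) ^ ((k : ℝ) * A') * (1 + τ) ^ ⌈(k : ℝ) * A'⌉₊ := by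
  have hD : 0 ≤ (D : ℝ) := Nat.cast_nonneg D
  have hB : 0 ≤ (D : ℝ) * (1 + τ) := mul_nonneg hD (by linarith)
  have h1 := rpow_le_of_le_translateHeight hHt hC₁ hB hHh hle hA'
  have h2 := mul_one_add_rpow_le hD hτ ((k : ℝ) * A')
  calc C₀ * Ht ^ A' ≤ C₀ * (C₁ ^ A' * ((D : ℝ) * (1 + τ)) ^ ((k : ℝ) * A') * Hh ^ ((k' : ℝ) * A')) := mul_le_mul_of_nonneg_left h1 hC₀
    _ ≤ C₀ * (C₁ ^ A' * ((D : ℝ) ^ ((k : ℝ) * A') * (1 + τ) ^ ⌈(k : ℝ) * A'⌉₊) * Hh ^ ((k' : ℝ) * A')) :=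
        mul_le_mul_of_nonneg_left (mul_le_mul_of_nonneg_right (mul_le_mul_of_nonneg_left h2 (Real.rpow_nonneg hC₁ _))
          (Real.rpow_nonneg hHh _)) hC₀
    _ = C₀ * C₁ ^ A' * Hh ^ ((k' : ℝ) * A') * (D : ℝ) ^ ((k : ℝ) * A') * (1 + τ) ^ ⌈(k : ℝ) * A'⌉₊ := by ring

open scoped ComplexOrder
open NumberField NumberField.mixedEmbedding NumberField.InfinitePlace IsDedekindDomain
open Literature.NumberTheory.Automorphic Literature.NumberTheory.Automorphic.UnitaryGroup

variable (F E : Type) [Field F] [NumberField F] [Field E] [NumberField E] [Algebra F E] (c : E ≃ₐ[F] E) (N : ℕ) (J : Matrix (Fin N) (Fin N) E)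
variable {S : Type*} [Fintype S]

/-- **(dec-3b-ii) THE LOWER POWER FACE IN THE TOP'S SHAPE.**  Frame data BY VALUE (as in §3), a centre `z` and radius `r₀ > 0` (the `hdecb` locality), and the constants
`C₁ ≥ 0`, `k k′ : ℕ` of a translate-height letter (★ (dec-3b-i) `K2LiuKindOneLineTranslateHeight.exists_leviRow_translate_height_le`: `‖Λ(γ[w])·h₀‖ ≤ C₁·(D·(1+τ))^k·‖h₀‖^{k′}`).
CONCLUSION: `∃ C a a₂ ≥ 0, ∃ Nb : ℕ` such that for every translate `h` (read `h := n_y · Λ(γ[w]) · h₀` in `H₁(𝔸)`), all movers, EVERY Iwasawa block decomposition with 1×1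
corner `y σ`, every `s` with `dist s z < r₀`, and all reals `Hh ≥ 0` (read `‖h₀‖`), `τ ≥ 0` (read `τ_S = ‖σ(S)‖`) and `D : ℕ` with `‖h‖ ≤ C₁·(D·(1+τ))^k·Hh^{k′}`:
`∏_σ ‖y σ 0 0‖ ^ (1 − 2 re s) ≤ C · Hh^a · D^{a₂} · (1 + τ)^{Nb}` — the engine's bytes `C·‖h‖^a·D^{a₂}·(1+τ_S)^{N}` for the factor `∏_σ |a₀₀((Λĝ·h)_σ)|^{1−2 re s}`.
[cite: BorelJacquet1979, §1.2, §4.1] [cite: MoeglinWaldspurger1995, II.1.5, II.1.7] [cite: Shimura1997, §A3] -/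
theorem linePower_le_of_translateHeight [NeZero N] (hc : c ≠ 1) (w : S → {w : InfinitePlace E // IsComplex w}) (hw : ∀ σ, c • (w σ).1 = (w σ).1)
    (r : Fin 1 ⊕ Fin 1 ≃ Fin N) (T Tinv : S → Matrix (Fin 1 ⊕ Fin 1) (Fin 1 ⊕ Fin 1) ℂ) (hT : ∀ σ, T σ * Tinv σ = 1) (hT' : ∀ σ, Tinv σ * T σ = 1)
    {M : ℝ} (hM : 1 ≤ M) (hTe : ∀ σ i j, ‖T σ i j‖ ≤ M) (hTe' : ∀ σ i j, ‖Tinv σ i j‖ ≤ M) (z : ℂ) {r₀ : ℝ} (hr₀ : 0 < r₀)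
    {C₁ : ℝ} (hC₁ : 0 ≤ C₁) (k k' : ℕ) :
    ∃ C a a₂ : ℝ, ∃ Nb : ℕ, 0 ≤ C ∧ 0 ≤ a ∧ 0 ≤ a₂ ∧ ∀ (h : (adelicGroupData F E c N J).Adelic) (y b d : S → Matrix (Fin 1) (Fin 1) ℂ)
      (κ κ' : S → Matrix (Fin 1 ⊕ Fin 1) (Fin 1 ⊕ Fin 1) ℂ),
      (∀ σ, κ σ * κ' σ = 1) → (∀ σ, κ' σ * κ σ = 1) → (∀ σ i j, ‖κ σ i j‖ ≤ M) → (∀ σ i j, ‖κ' σ i j‖ ≤ M) →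
      (∀ σ, T σ * Matrix.reindex r.symm r.symm
          ((((archAt F E c N J (w σ) (hw σ) hc (archPart F E c N J h) : archLocal E N J (w σ)) : GL (Fin N) ℂ) : Matrix (Fin N) (Fin N) ℂ)) *
          Tinv σ = Matrix.fromBlocks (y σ) (b σ) 0 (d σ) * κ σ) →
      ∀ s : ℂ, dist s z < r₀ → ∀ (Hh τ : ℝ) (D : ℕ), 0 ≤ Hh → 0 ≤ τ →
        adelicHeightGL N E (adelicVal F E c N J h) ≤ C₁ * ((D : ℝ) * (1 + τ)) ^ k * Hh ^ k' →
        ∏ σ, ‖y σ 0 0‖ ^ (1 - 2 * s.re) ≤ C * Hh ^ a * (D : ℝ) ^ a₂ * (1 + τ) ^ Nb := by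
  obtain ⟨C₀, A', hC₀, hA', hface⟩ := linePower_le_height_rpow_of_dist F E c N J hc w hw r T Tinv hT hT' hM hTe hTe' z hr₀
  refine ⟨C₀ * C₁ ^ A', (k' : ℝ) * A', (k : ℝ) * A', ⌈(k : ℝ) * A'⌉₊, mul_nonneg hC₀ (Real.rpow_nonneg hC₁ _),
    mul_nonneg (Nat.cast_nonneg k') hA', mul_nonneg (Nat.cast_nonneg k) hA',
    fun h y b d κ κ' hκ hκ' hκe hκe' hdec s hs Hh τ D hHh hτ hle => ?_⟩
  have h1 := hface h y b d κ κ' hκ hκ' hκe hκe' hdec s hs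
  exact h1.trans (mul_rpow_le_top_shape hC₀ hA' (adelicHeightGL_nonneg _) hC₁ hHh hτ hle)

end Top

end Summit.HodgeConjecture.HodgeConjecture.Cruxes.HLiu418.K2LiuKindOneLineDecayLowerPowerFace

end
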